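import Summits.ResolutionOfSingularities.ResolutionOfSingularities.Theorems.PurelyInseparableDim4ResConeTwoSlotRotationStep
import HarnessLib
import HarnessLib.Audit.Tags

/-!
# Purely inseparable four-folds — TWO-SLOT TAIL WITH ROTATIONS: the slot-letter bookkeeping (cell `res-dim4-pi`,
# K2(p) lane, slice B brick K24a, part γ″, file 1)

[OURS · counted 0 · cell `res-dim4-pi` · K2(p) lane (holder res-dim4-p-12; «p-1 takes K24a» 2026-08-29 01:14Z); seat
res-dim4-p-1 g4 over res-dim4-p-2 g5's one-step lemmas `r_succ_of_rotation`, `r_succ_of_slot'`, `slot_or_free` and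
its own `exists_slot_letters`.]  Nothing here proves K2(p)/K2(5), `NoIsolatedTrap p p` or resolution of
singularities in dimension ≥ 4 / characteristic `p`.  AI kernel work, weaker than expert review.

SETTING.  A witnessed chain with `ord₀ F_k = q + 1`, weight-`1` boundaries of size `3` through an idle letter `ν`
(`1 ≤ r_k ν`, `j k ≠ ν`, `b k ν = 0`) from `k₂` on.  Then `r_k = e_{A_k} + e_{B_k} + e_ν` with two SLOT letters and one
FREE letter `Y_k`, and every step is one of four kinds: a slot step charting `A_k` or `B_k` (letters kept,
translation along `Y_k`), or a ROTATION charting `Y_k` and losing `A_k` (then `A_{k+1} = Y_k`, `Y_{k+1} = A_k`) or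
`B_k` (symmetrically).  The letters are defined recursively along the chain; `L m` := «step `m` touches `A_m`».

* **`twoSlot_letters`** — the functions `A, B, Y : ℕ → Fin 4` and `L : ℕ → Prop` with, at every `m`, pairwise
  distinctness of `A_m, B_m, ν, Y_m`, the boundary `r_{k₂+m} = e_{A_m} + e_{B_m} + e_ν`, and the four-way step
  classification with the letter updates — the slot bookkeeping `hA/hstepA/hB/hstepB` of the rotating two-slot game
  (`no_twoSlot_tail_of_readings_rotating`) and the letters of its readings.

[cite: CossartJannsenSaito2020, Thm. 3.14] [cite: HauserPerlega2019PRIMS, §2 (transform D' of D)]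
bears_on: LADDER-RESOLUTION:D157-DOOR2 (res-dim4-pi · K2(p) · slice B · K24a-γ″).  Supports
stmt-ResolutionOfSingularities-16155 (helper).
-/

set_option linter.dupNamespace false -- mandated namespace of this single-conjunct summit

noncomputable section

namespace Summit.ResolutionOfSingularities.ResolutionOfSingularities.Theorems.PIDim4

namespace ResCone

open MvPolynomial Finset
open Literature.AlgebraicGeometry.Resolution
open Literature.AlgebraicGeometry.Resolution.CentreBlowup
open Literature.AlgebraicGeometry.Resolution.Hauser2010
open Literature.AlgebraicGeometry.Resolution.HauserPerlega2019

variable {K : Type} [Field K]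

section Letters

variable [DecidableEq K]

/-- **THE SLOT-LETTER BOOKKEEPING OF THE TWO-SLOT TAIL, ROTATIONS INCLUDED** (setting in the module docstring).
[OURS] [cite: CossartJannsenSaito2020, Thm. 3.14] -/
theorem twoSlot_letters (q : ℕ) {c : ℕ → State K} {j : ℕ → Fin 4} {b : ℕ → Fin 4 → K}
    (hw : FreeTail.IsWitnessedChain q c j b) {k₂ : ℕ}
    (ho : ∀ k, k₂ ≤ k → ordZero (c k).F = ((q + 1 : ℕ) : ℕ∞))
    (hwt : ∀ k, k₂ ≤ k → (∀ i, (c k).r i ≤ 1) ∧ (c k).r.degree = 3) {ν : Fin 4}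
    (hidle : ∀ k, k₂ ≤ k → 1 ≤ (c k).r ν ∧ j k ≠ ν ∧ b k ν = 0) :
    ∃ (A B Y : ℕ → Fin 4) (L : ℕ → Prop), ∀ m,
      (A m ≠ B m ∧ A m ≠ ν ∧ A m ≠ Y m ∧ B m ≠ ν ∧ B m ≠ Y m ∧ ν ≠ Y m) ∧
      (c (k₂ + m)).r = Finsupp.single (A m) 1 + Finsupp.single (B m) 1 + Finsupp.single ν 1 ∧
      ((L m ∧ j (k₂ + m) = A m ∧ b (k₂ + m) = Pi.single (Y m) (b (k₂ + m) (Y m)) ∧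
          A (m + 1) = A m ∧ B (m + 1) = B m ∧ Y (m + 1) = Y m) ∨
        (¬ L m ∧ j (k₂ + m) = B m ∧ b (k₂ + m) = Pi.single (Y m) (b (k₂ + m) (Y m)) ∧
          A (m + 1) = A m ∧ B (m + 1) = B m ∧ Y (m + 1) = Y m) ∨
        (L m ∧ j (k₂ + m) = Y m ∧ b (k₂ + m) = Pi.single (A m) (b (k₂ + m) (A m)) ∧ b (k₂ + m) (A m) ≠ 0 ∧
          A (m + 1) = Y m ∧ B (m + 1) = B m ∧ Y (m + 1) = A m) ∨
        (¬ L m ∧ j (k₂ + m) = Y m ∧ b (k₂ + m) = Pi.single (B m) (b (k₂ + m) (B m)) ∧ b (k₂ + m) (B m) ≠ 0 ∧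
          A (m + 1) = A m ∧ B (m + 1) = Y m ∧ Y (m + 1) = B m)) := by
  -- the letters at `k₂`
  have hν1 : (c k₂).r ν = 1 := le_antisymm ((hwt k₂ le_rfl).1 ν) (hidle k₂ le_rfl).1
  obtain ⟨A₀, B₀, Y₀, hAB₀, hAν₀, hAY₀, hBν₀, hBY₀, hνY₀, hr₀⟩ := exists_slot_letters (hwt k₂ le_rfl).1 (hwt k₂ le_rfl).2 hν1
  -- the recursion
  let step : ℕ → Fin 4 × Fin 4 × Fin 4 → Fin 4 × Fin 4 × Fin 4 := fun m S =>
    if j (k₂ + m) = S.1 then S else if j (k₂ + m) = S.2.1 then S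
      else if b (k₂ + m) S.1 ≠ 0 then (S.2.2, S.2.1, S.1) else (S.1, S.2.2, S.2.1)
  let S : ℕ → Fin 4 × Fin 4 × Fin 4 := fun m => @Nat.rec (fun _ => Fin 4 × Fin 4 × Fin 4) (A₀, B₀, Y₀) step m
  have hS0 : S 0 = (A₀, B₀, Y₀) := rfl
  have hS : ∀ m, S (m + 1) = step m (S m) := fun m => rfl
  -- the invariant and the classification, one step at a time
  have key : ∀ m, ((S m).1 ≠ (S m).2.1 ∧ (S m).1 ≠ ν ∧ (S m).1 ≠ (S m).2.2 ∧ (S m).2.1 ≠ ν ∧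
      (S m).2.1 ≠ (S m).2.2 ∧ ν ≠ (S m).2.2) →
      (c (k₂ + m)).r = Finsupp.single (S m).1 1 + Finsupp.single (S m).2.1 1 + Finsupp.single ν 1 →
      (((S (m + 1)).1 ≠ (S (m + 1)).2.1 ∧ (S (m + 1)).1 ≠ ν ∧ (S (m + 1)).1 ≠ (S (m + 1)).2.2 ∧
          (S (m + 1)).2.1 ≠ ν ∧ (S (m + 1)).2.1 ≠ (S (m + 1)).2.2 ∧ ν ≠ (S (m + 1)).2.2) ∧
        (c (k₂ + (m + 1))).r =
          Finsupp.single (S (m + 1)).1 1 + Finsupp.single (S (m + 1)).2.1 1 + Finsupp.single ν 1) ∧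
      (((j (k₂ + m) = (S m).1 ∨ b (k₂ + m) (S m).1 ≠ 0) ∧ j (k₂ + m) = (S m).1 ∧
          b (k₂ + m) = Pi.single (S m).2.2 (b (k₂ + m) (S m).2.2) ∧ S (m + 1) = S m) ∨
        (¬ (j (k₂ + m) = (S m).1 ∨ b (k₂ + m) (S m).1 ≠ 0) ∧ j (k₂ + m) = (S m).2.1 ∧
          b (k₂ + m) = Pi.single (S m).2.2 (b (k₂ + m) (S m).2.2) ∧ S (m + 1) = S m) ∨
        ((j (k₂ + m) = (S m).1 ∨ b (k₂ + m) (S m).1 ≠ 0) ∧ j (k₂ + m) = (S m).2.2 ∧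
          b (k₂ + m) = Pi.single (S m).1 (b (k₂ + m) (S m).1) ∧ b (k₂ + m) (S m).1 ≠ 0 ∧
          S (m + 1) = ((S m).2.2, (S m).2.1, (S m).1)) ∨
        (¬ (j (k₂ + m) = (S m).1 ∨ b (k₂ + m) (S m).1 ≠ 0) ∧ j (k₂ + m) = (S m).2.2 ∧
          b (k₂ + m) = Pi.single (S m).2.1 (b (k₂ + m) (S m).2.1) ∧ b (k₂ + m) (S m).2.1 ≠ 0 ∧
          S (m + 1) = ((S m).1, (S m).2.2, (S m).2.1))) := by
    intro m hd hr
    obtain ⟨hAB, hAν, hAY, hBν, hBY, hνY⟩ := hd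
    have hk : k₂ ≤ k₂ + m := Nat.le_add_right _ _
    have hdeg : (c (k₂ + m + 1)).r.degree = (c (k₂ + m)).r.degree := by
      rw [(hwt _ (by omega)).2, (hwt _ hk).2]
    have hq := triple_apply hAB hAν hAY hBν hBY hνY
    rw [show k₂ + (m + 1) = k₂ + m + 1 from rfl]
    rcases slot_or_free hAB hAν hAY hBν hBY hνY (hidle _ hk).2.1 with hjs | hjY
    · -- a slot step: letters kept
      obtain ⟨hr', hb⟩ := r_succ_of_slot' q hw (ho _ hk) hdeg hAB hAν hAY hBν hBY hνY hr hjs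
      have hbA : b (k₂ + m) (S m).1 = 0 := by rw [hb, Pi.single_eq_of_ne hAY]
      rcases hjs with hjA | hjB
      · have hS1 : S (m + 1) = S m := by rw [hS]; simp only [step]; rw [if_pos hjA]
        rw [hS1]
        exact ⟨⟨⟨hAB, hAν, hAY, hBν, hBY, hνY⟩, hr'⟩, Or.inl ⟨Or.inl hjA, hjA, hb, rfl⟩⟩
      · have hjA : j (k₂ + m) ≠ (S m).1 := by rw [hjB]; exact hAB.symm
        have hS1 : S (m + 1) = S m := by rw [hS]; simp only [step]; rw [if_neg hjA, if_pos hjB]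
        rw [hS1]
        refine ⟨⟨⟨hAB, hAν, hAY, hBν, hBY, hνY⟩, hr'⟩, Or.inr (Or.inl ⟨?_, hjB, hb, rfl⟩)⟩
        push Not
        exact ⟨hjA, hbA⟩
    · -- a rotation: one slot is lost and becomes the free letter
      have hjA : j (k₂ + m) ≠ (S m).1 := by rw [hjY]; exact hAY.symm
      have hjB : j (k₂ + m) ≠ (S m).2.1 := by rw [hjY]; exact hBY.symm
      rcases r_succ_of_rotation q hw (ho _ hk) hdeg hAB hAν hAY hBν hBY hνY hr hjY (hidle _ hk).2.2 with
        ⟨hbA, hb, hr'⟩ | ⟨hbB, hb, hr'⟩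
      · have hS1 : S (m + 1) = ((S m).2.2, (S m).2.1, (S m).1) := by
          rw [hS]; simp only [step]; rw [if_neg hjA, if_neg hjB, if_pos hbA]
        rw [hS1]
        exact ⟨⟨⟨hBY.symm, hνY.symm, hAY.symm, hBν, hAB.symm, hAν.symm⟩, hr'⟩,
          Or.inr (Or.inr (Or.inl ⟨Or.inr hbA, hjY, hb, hbA, rfl⟩))⟩
      · have hbA : b (k₂ + m) (S m).1 = 0 := by rw [hb, Pi.single_eq_of_ne hAB]
        have hS1 : S (m + 1) = ((S m).1, (S m).2.2, (S m).2.1) := by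
          rw [hS]; simp only [step]; rw [if_neg hjA, if_neg hjB, if_neg (not_not.mpr hbA)]
        rw [hS1]
        refine ⟨⟨⟨hAY, hAν, hAB, hνY.symm, hBY.symm, hBν.symm⟩, ?_⟩,
          Or.inr (Or.inr (Or.inr ⟨?_, hjY, hb, hbB, rfl⟩))⟩
        · rw [hr', add_right_comm (Finsupp.single (S m).2.2 1) (Finsupp.single (S m).1 1)]
          -- `e_Y + e_A + e_ν` with the summands reordered
          simp only [add_comm, add_left_comm]
        · push Not
          exact ⟨hjA, hbA⟩
  -- the invariant at every stage
  have hinv : ∀ m, ((S m).1 ≠ (S m).2.1 ∧ (S m).1 ≠ ν ∧ (S m).1 ≠ (S m).2.2 ∧ (S m).2.1 ≠ ν ∧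
      (S m).2.1 ≠ (S m).2.2 ∧ ν ≠ (S m).2.2) ∧
      (c (k₂ + m)).r = Finsupp.single (S m).1 1 + Finsupp.single (S m).2.1 1 + Finsupp.single ν 1 := by
    intro m
    induction m with
    | zero => rw [hS0]; exact ⟨⟨hAB₀, hAν₀, hAY₀, hBν₀, hBY₀, hνY₀⟩, by simpa using hr₀⟩
    | succ m ih => exact (key m ih.1 ih.2).1
  refine ⟨fun m => (S m).1, fun m => (S m).2.1, fun m => (S m).2.2,
    fun m => j (k₂ + m) = (S m).1 ∨ b (k₂ + m) (S m).1 ≠ 0, fun m => ⟨(hinv m).1, (hinv m).2, ?_⟩⟩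
  rcases (key m (hinv m).1 (hinv m).2).2 with ⟨hL, hj, hb, hS1⟩ | ⟨hL, hj, hb, hS1⟩ | ⟨hL, hj, hb, hb0, hS1⟩ |
    ⟨hL, hj, hb, hb0, hS1⟩
  · exact Or.inl ⟨hL, hj, hb, by simp only [hS1], by simp only [hS1], by simp only [hS1]⟩
  · exact Or.inr (Or.inl ⟨hL, hj, hb, by simp only [hS1], by simp only [hS1], by simp only [hS1]⟩)
  · exact Or.inr (Or.inr (Or.inl ⟨hL, hj, hb, hb0, by simp only [hS1], by simp only [hS1], by simp only [hS1]⟩))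
  · exact Or.inr (Or.inr (Or.inr ⟨hL, hj, hb, hb0, by simp only [hS1], by simp only [hS1], by simp only [hS1]⟩))

end Letters

end ResCone

end Summit.ResolutionOfSingularities.ResolutionOfSingularities.Theorems.PIDim4

end
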